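import Mathlib
import Summits.NavierStokesRegularity.NavierStokesRegularity.Theorems.FilamentSkeletonRssStadiumKernelPieces
import Literature.Analysis.Complex.HolomorphicParametricIntegral

/-!
# Route `FilamentSkeletonRss` · child crux `TangentSkeletonNearStraightL` (stmt-NavierStokesRegularity-23320) · registered line
# `child_tangent_analytic_strip_L` (b0b56c52900dd90a), stub `stub_stripPropagation` — brick: PIECES OVER A FIXED SOURCE CONTOUR ARE HOLOMORPHIC

Third assembly step of R7 (STUB-PLAN memo attached to 23320): in the Cauchy-rectangle argument the continued field is represented near each point by
integrals over a z-INDEPENDENT source contour (real far part, vertical connectors, a horizontal segment at fixed height).  Along any such piece the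
source data are fixed continuous functions of the parameter — position `P(t) ∈ ℂ³`, tangent `D(t) ∈ ℂ³`, core term `Gc(t) ∈ ℂ` — and the integrand
`((Σᵢ(Fᵢ(z) − Pᵢ(t))² + κ·Gc(t))^{3/2})⁻¹ • (D(t) ⨯₃ (F(z) − P(t)))` is holomorphic in the target `z`.  `differentiableOn_fixedSourcePiece`: with `F`
holomorphic on an open `V`, the principal-branch condition on `V × T` and a `z`-uniform integrable majorant on the measurable parameter set `T`, the
piece `z ↦ ∫_{t∈T} …` is holomorphic on `V` (tree: `HolomorphicParametricIntegral.differentiableOn_integral_of_dominated`).  The unshifted real-source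
piece (`Theorems.StadiumFarPieceHolomorphic`) is the case `P = cplx ∘ X`, `D = cplx ∘ X′`, `Gc = A`.
HONEST FRAMING: a brick for a plan about a HYPOTHETICAL filament skeleton on the NEGATIVE side of a MODEL route; the stub `stub_stripPropagation` is NOT
closed; nothing here bears on Navier–Stokes regularity or blow-up.  `--supports stmt-NavierStokesRegularity-23320`.
-/

set_option linter.dupNamespace false

noncomputable section

namespace Summit.NavierStokesRegularity.NavierStokesRegularity.Theorems.StadiumFixedSourcePiece

open Set Filter Topology Complex MeasureTheory Metric
open scoped Matrix

/-- **Pieces over a fixed source contour are holomorphic in the target.**  See the module docstring. [folklore] -/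
theorem differentiableOn_fixedSourcePiece {V : Set ℂ} (hV : IsOpen V) {F : ℂ → (Fin 3 → ℂ)} (hF : DifferentiableOn ℂ F V)
    {P D : ℝ → (Fin 3 → ℂ)} {Gc : ℝ → ℂ} (hP : Continuous P) (hD : Continuous D) (hGc : Continuous Gc) {κ : ℝ}
    {T : Set ℝ} (hT : MeasurableSet T)
    (hpos : ∀ z ∈ V, ∀ t ∈ T, 0 < ((∑ i, (F z i - P t i) ^ 2) + (κ : ℂ) * Gc t).re)
    {bound : ℝ → ℝ} (hbound : IntegrableOn bound T)
    (hdom : ∀ z ∈ V, ∀ t ∈ T,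
      ‖(((∑ i, (F z i - P t i) ^ 2) + (κ : ℂ) * Gc t) ^ ((3:ℂ) / 2))⁻¹ • (D t ⨯₃ (fun i => F z i - P t i))‖ ≤ bound t) :
    DifferentiableOn ℂ (fun z => ∫ t in T,
      (((∑ i, (F z i - P t i) ^ 2) + (κ : ℂ) * Gc t) ^ ((3:ℂ) / 2))⁻¹ • (D t ⨯₃ (fun i => F z i - P t i))) V := by
  set W : ℂ → ℝ → ℂ := fun z t => (∑ i, (F z i - P t i) ^ 2) + (κ : ℂ) * Gc t with hW
  set Num : ℂ → ℝ → (Fin 3 → ℂ) := fun z t => D t ⨯₃ (fun i => F z i - P t i) with hNum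
  have hPi : ∀ i, Continuous fun t => P t i := fun i => (continuous_apply i).comp hP
  have hDi : ∀ i, Continuous fun t => D t i := fun i => (continuous_apply i).comp hD
  -- for fixed `z`: continuity in `t` on `T`
  have hKcont : ∀ z ∈ V, ContinuousOn (fun t => ((W z t) ^ ((3:ℂ) / 2))⁻¹ • Num z t) T := by
    intro z hz
    have hWt : Continuous (W z) := by
      have h1 : ∀ i, Continuous fun t => (F z i - P t i) ^ 2 := fun i => (continuous_const.sub (hPi i)).pow 2
      exact (continuous_finsetSum _ fun i _ => h1 i).add (continuous_const.mul hGc)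
    have hNt : Continuous (Num z) := by
      have hbi : ∀ i, Continuous fun t => F z i - P t i := fun i => continuous_const.sub (hPi i)
      refine continuous_pi fun i => ?_
      fin_cases i
      · simpa [hNum, cross_apply, Pi.mul_def, Pi.sub_def] using ((hDi 1).mul (hbi 2)).sub ((hDi 2).mul (hbi 1))
      · simpa [hNum, cross_apply, Pi.mul_def, Pi.sub_def] using ((hDi 2).mul (hbi 0)).sub ((hDi 0).mul (hbi 2))
      · simpa [hNum, cross_apply, Pi.mul_def, Pi.sub_def] using ((hDi 0).mul (hbi 1)).sub ((hDi 1).mul (hbi 0))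
    intro t ht
    have hc : ContinuousAt (fun w : ℂ => (w ^ ((3:ℂ) / 2))⁻¹) (W z t) :=
      (Summit.NavierStokesRegularity.NavierStokesRegularity.Theorems.StadiumKernelPieces.differentiableAt_inv_cpow_threeHalves (hpos z hz t ht)).continuousAt
    exact (ContinuousAt.comp_continuousWithinAt (f := W z) hc hWt.continuousWithinAt).smul hNt.continuousWithinAt
  -- for fixed `t ∈ T`: holomorphy in `z`
  have hKdiff : ∀ t ∈ T, DifferentiableOn ℂ (fun z => ((W z t) ^ ((3:ℂ) / 2))⁻¹ • Num z t) V := by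
    intro t ht
    have hFi : ∀ i, DifferentiableOn ℂ (fun z => F z i - P t i) V := fun i => (differentiableOn_pi.1 hF i).sub_const _
    have hWd : DifferentiableOn ℂ (fun z => W z t) V :=
      (DifferentiableOn.fun_sum fun i _ => (hFi i).pow 2).add_const _
    have hpow : DifferentiableOn ℂ (fun z => ((W z t) ^ ((3:ℂ) / 2))⁻¹) V := by
      intro z hz
      exact DifferentiableAt.comp_differentiableWithinAt (g := fun w : ℂ => (w ^ ((3:ℂ) / 2))⁻¹) (f := fun z => W z t) z
        (Summit.NavierStokesRegularity.NavierStokesRegularity.Theorems.StadiumKernelPieces.differentiableAt_inv_cpow_threeHalves (hpos z hz t ht))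
        (hWd z hz)
    have hNd : DifferentiableOn ℂ (fun z => Num z t) V := by
      have hai : ∀ i, DifferentiableOn ℂ (fun _ : ℂ => D t i) V := fun i => differentiableOn_const _
      refine differentiableOn_pi.2 fun i => ?_
      fin_cases i
      · simpa [hNum, cross_apply, Pi.mul_def, Pi.sub_def] using ((hai 1).mul (hFi 2)).sub ((hai 2).mul (hFi 1))
      · simpa [hNum, cross_apply, Pi.mul_def, Pi.sub_def] using ((hai 2).mul (hFi 0)).sub ((hai 0).mul (hFi 2))
      · simpa [hNum, cross_apply, Pi.mul_def, Pi.sub_def] using ((hai 0).mul (hFi 1)).sub ((hai 1).mul (hFi 0))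
    exact hpow.smul hNd
  refine Literature.Analysis.Complex.differentiableOn_integral_of_dominated (μ := volume.restrict T) ?_ ?_ ?_
  · intro z hz
    exact (hKcont z hz).aestronglyMeasurable hT
  · exact ae_restrict_of_forall_mem hT fun t ht => hKdiff t ht
  · intro x₀ hx₀
    obtain ⟨r, hr, hrV⟩ := Metric.isOpen_iff.1 hV x₀ hx₀
    refine ⟨r, hr, hrV, bound, hbound, ?_⟩
    exact ae_restrict_of_forall_mem hT fun t ht p hp => hdom p (hrV hp) t ht

end Summit.NavierStokesRegularity.NavierStokesRegularity.Theorems.StadiumFixedSourcePiece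

end
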